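import Summits.KontsevichZagierPeriods.KontsevichZagierPeriods.Theorems.ValuedFieldSpecialisationCTConstructionCylinder
import Summits.KontsevichZagierPeriods.KontsevichZagierPeriods.Theorems.ValuedFieldSpecialisationCTConstructionElementarySliceValue

/-!
# Route ValuedFieldSpecialisation — crux `CTConstruction`: the total class of the log family

Helper toward crux stmt-KontsevichZagierPeriods-3495 (`CTConstruction`), line `registered`, stub
`stub_logFamily_total` (weight `1` of the lead's moment method). The log-elementary divergent
product family `P = P(p = 0, q, b = 1, d, r)` of the route lives in coordinates
`z = (s, u, y, w) = vecCons s (vecCons u (Fin.append y w))` on the domain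
`0 < s < 1`, `0 < u`, `u ^ q · s ^ 0 < 1`, `s ≤ y ≤ 1`, `w ∈ r.domain`, with integrand
`y⁻¹ · r.integrand w`; its slices are `log (1/s) · [r]` and its value is
`∫₀¹ log (1/s) ds · r.value = r.value`. We prove the CLASS-LEVEL identity
`[P] − [r] ∈ KZ.relations` (`stub_logFamily_total`) by an explicit chain of moves:

1. rotate coordinates so that the parameter `s` becomes the LAST coordinate (a change of
   variables, `KZ.of_sub_of_reindex_mem_relations`; `exists_reindex_logFamily`): the rotated family
   `P'` lives in coordinates `(u, y, w, s)` on `0 < u < 1`, `0 < s < 1`, `s ≤ y ≤ 1`, `w ∈ r.domain`;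
2. up to the null faces `{s = 0}` and `{y = 1}` (domain additivity with a null piece,
   `KZ.IntegralRep.of_sub_of_restrict_mem_relations`), `P'` is the Newton–Leibniz band
   `{(x, s) | x ∈ (0,1) × (0,1) × r.domain, 0 ≤ s ≤ y}` whose integrand `y⁻¹ · r(w)` is constant
   along the fibres; ONE Newton–Leibniz move with primitive `F = s · y⁻¹ · r(w)` and edges
   `0 ≤ y` (`of_sub_of_mem_relations_of_coordBand`) lands on the double constant family
   `r.cylinder.cylinder = (0,1) × ((0,1) × r)`, integrand `y · y⁻¹ · r(w) = r(w)`
   (`of_sub_of_mem_relations_of_rotated`);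
3. constant families specialise: `[r.cylinder.cylinder] ≡ [r.cylinder] ≡ [r]`
   (`of_cylinder_sub_of_mem_relations`, file `…CTConstructionCylinder`).

Sources: M. Kontsevich, D. Zagier, *Periods* (2001), §1.2, rules (1)–(3). No new definitions;
everything is proved (the integrability of the band is inherited from that of `P`).
-/

noncomputable section

namespace Summit.KontsevichZagierPeriods.ValuedFieldSpecialisation

open MeasureTheory Set Filter MvPolynomial
open Literature.NumberTheory.Transcendental Literature.NumberTheory.Transcendental.KZ
open Literature.ModelTheory.ExponentialFields (IsSemialgebraic isSemialgebraic_setOf_eval_le)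

variable {d : ℕ}

/-! ### A Newton–Leibniz band whose roof is a coordinate -/

/-- **Newton–Leibniz under a coordinate roof.** Let `B` be a base representation in dimension `n`,
`i` a coordinate with `0 ≤ x i` on `B.domain`, and `R` the representation on the band
`{(x, t) | x ∈ B.domain, 0 ≤ t ≤ x i}` whose integrand is constant along the fibres,
`R.integrand (x, t) = g x`. If `B.integrand x = x i · g x` on `B.domain`, then `[R] − [B]` is one
Newton–Leibniz move (primitive `F (x, t) = t · g x`, edges `a = 0 ≤ b = x i`), hence a relation.
[Kontsevich–Zagier 2001, §1.2 rule (3)] [folklore] -/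
theorem of_sub_of_mem_relations_of_coordBand {n : ℕ} (R : IntegralRep (n + 1)) (B : IntegralRep n)
    (i : Fin n) (g : (Fin n → ℝ) → ℝ) (hpos : ∀ x ∈ B.domain, 0 ≤ x i)
    (hdom : R.domain = {z : Fin (n + 1) → ℝ | (Fin.init z : Fin n → ℝ) ∈ B.domain ∧
      0 ≤ z (Fin.last n) ∧ z (Fin.last n) ≤ Fin.init z i})
    (hR : ∀ z ∈ R.domain, R.integrand z = g (Fin.init z))
    (hB : ∀ x ∈ B.domain, B.integrand x = x i * g x) :
    of R - of B ∈ relations := by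
  refine newtonLeibnizRel_subset_relations ⟨n, R, B, fun _ => 0, fun x => x i,
    fun z => z (Fin.last n) * g (Fin.init z), ?_, ?_,
    isSemialgebraicFunOn_apply B.isSemialgebraic_domain i, fun x hx => hpos x hx, hdom,
    ?_, ?_, ?_, rfl⟩
  · -- `F = X_last · (g ∘ init)` agrees on the band with `X_last · R.integrand`
    exact (IsSemialgebraicFunOn.mul_holds
      (isSemialgebraicFunOn_apply R.isSemialgebraic_domain (Fin.last n))
      R.isSemialgebraicFunOn_integrand).congr fun z hz => by
        simp only [Pi.mul_apply, hR z hz]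
  · -- the lower edge `a = 0`
    exact (isSemialgebraicFunOn_aeval B.isSemialgebraic_domain
      (0 : MvPolynomial (Fin n) ℚ)).congr fun x _ => by simp
  · -- continuity of `t ↦ t · g x` on the closed fibre
    intro x _
    simp only [Fin.snoc_last, Fin.init_snoc]
    fun_prop
  · -- `d/dt (t · g x) = g x = R.integrand (x, t)` on the open fibre
    intro x hx t ht
    have hmem : (Fin.snoc x t : Fin (n + 1) → ℝ) ∈ R.domain := by
      rw [hdom]
      simp only [mem_setOf_eq, Fin.init_snoc, Fin.snoc_last]
      exact ⟨hx, ht.1.le, ht.2.le⟩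
    simp only [Fin.snoc_last, Fin.init_snoc]
    rw [hR _ hmem, Fin.init_snoc]
    exact hasDerivAt_mul_const _
  · -- the boundary term `x i · g x − 0 · g x`
    intro x hx
    simp only [Fin.snoc_last, Fin.init_snoc]
    rw [hB x hx]
    ring

/-! ### Step 1: rotating the parameter to the last coordinate -/

/-- **Rotation.** For the log family `P` (coordinates `(s, u, y, w)`, `0 < q`) there is a
representation `P'` in coordinates `(u, y, w, s)` — the reindexing of `P` along the rotation
`0 ↦ last`, `i + 1 ↦ i` — with `[P] − [P'] ∈ KZ.relations` (`KZ.of_sub_of_reindex_mem_relations`),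
domain `0 < s < 1`, `0 < u < 1`, `s ≤ y ≤ 1`, `w ∈ r.domain` (`u ^ q · s ^ 0 < 1 ↔ u < 1`), and
integrand `y⁻¹ · r.integrand w`. [Kontsevich–Zagier 2001, §1.2 rule (2)] [folklore] -/
theorem exists_reindex_logFamily {q : ℕ} (hq : 0 < q) (r : IntegralRep d)
    (P : IntegralRep (1 + d + 1 + 1))
    (hdom : P.domain = {z | ∃ (s u : ℝ) (y : Fin 1 → ℝ) (w : Fin d → ℝ),
      z = Matrix.vecCons s (Matrix.vecCons u (Fin.append y w)) ∧ 0 < s ∧ s < 1 ∧ 0 < u ∧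
        u ^ q * s ^ 0 < 1 ∧ (∀ j, s ≤ y j ∧ y j ≤ 1) ∧ w ∈ r.domain})
    (hint : P.integrand = fun z => (∏ j : Fin 1, (z (Fin.castAdd d j).succ.succ)⁻¹) *
      r.integrand (fun l : Fin d => z (Fin.natAdd 1 l).succ.succ)) :
    ∃ P' : IntegralRep (d + 1 + 1 + 1), of P - of P' ∈ relations ∧
      (∀ z, z ∈ P'.domain ↔ (0 < z (Fin.last (d + 1 + 1)) ∧ z (Fin.last (d + 1 + 1)) < 1) ∧
        (0 < z 0 ∧ z 0 < 1) ∧ (z (Fin.last (d + 1 + 1)) ≤ z 1 ∧ z 1 ≤ 1) ∧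
        (fun l : Fin d => z l.castSucc.succ.succ) ∈ r.domain) ∧
      P'.integrand = fun z => (z 1)⁻¹ * r.integrand (fun l : Fin d => z l.castSucc.succ.succ) := by
  have hd : 1 + d + 1 = d + 1 + 1 := by omega
  -- the rotation `0 ↦ last`, `i + 1 ↦ i`
  let e : Fin (1 + d + 1 + 1) ≃ Fin (d + 1 + 1 + 1) :=
    { toFun := Fin.cons (Fin.last (d + 1 + 1)) (fun i => Fin.castSucc (i.cast hd))
      invFun := Fin.snoc (fun k => Fin.succ (k.cast hd.symm)) 0
      left_inv := fun i => by refine Fin.cases ?_ (fun j => ?_) i <;> simp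
      right_inv := fun k => by refine Fin.lastCases ?_ (fun j => ?_) k <;> simp }
  have he0 : e 0 = Fin.last _ := by simp [e]
  have he1 : e 1 = 0 := by
    show e (Fin.succ 0) = 0
    simp [e]
  have hey : ∀ j : Fin 1, e (Fin.castAdd d j).succ.succ = 1 := by
    intro j
    obtain rfl : j = 0 := Subsingleton.elim _ _
    simp only [e, Equiv.coe_fn_mk, Fin.cons_succ]
    ext
    simp
  have hew : ∀ l : Fin d, e (Fin.natAdd 1 l).succ.succ = l.castSucc.succ.succ := by
    intro l
    simp only [e, Equiv.coe_fn_mk, Fin.cons_succ]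
    ext
    simp [Fin.val_succ]
  have hq0 : q ≠ 0 := hq.ne'
  refine ⟨P.reindex e, of_sub_of_reindex_mem_relations P e, fun z => ?_, ?_⟩
  · rw [IntegralRep.reindex_domain, mem_setOf_eq, hdom, elementaryDomain_eq 0 q 1 r]
    simp only [mem_setOf_eq, he0, he1, hey, hew, pow_zero, mul_one, Fin.forall_fin_one]
    constructor
    · rintro ⟨hs, hs1, hu, huq, hy, hw⟩
      exact ⟨⟨hs, hs1⟩, ⟨hu, (pow_lt_one_iff_of_nonneg hu.le hq0).1 huq⟩, hy, hw⟩
    · rintro ⟨⟨hs, hs1⟩, ⟨hu, hu1⟩, hy, hw⟩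
      exact ⟨hs, hs1, hu, (pow_lt_one_iff_of_nonneg hu.le hq0).2 hu1, hy, hw⟩
  · funext z
    simp only [IntegralRep.reindex_integrand, hint, hey, hew, Fin.prod_univ_one]

/-! ### Steps 2–3: the rotated family is a Newton–Leibniz band over the double cylinder -/

/-- **The rotated log family is move-equivalent to its coefficient.** If `P'` lives in coordinates
`(u, y, w, s)` on `0 < s < 1`, `0 < u < 1`, `s ≤ y ≤ 1`, `w ∈ r.domain` with integrand
`y⁻¹ · r.integrand w`, then `[P'] − [r] ∈ KZ.relations`: up to the null faces `{y = 1}`, `{s = 0}`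
(rule (1)) `P'` is the band `0 ≤ s ≤ y` over the double constant family
`r.cylinder.cylinder = (0,1) × ((0,1) × r)`, one Newton–Leibniz move (rule (3), primitive
`s · y⁻¹ · r(w)`) lands on `r.cylinder.cylinder`, and constant families specialise
(`of_cylinder_sub_of_mem_relations`, twice). [Kontsevich–Zagier 2001, §1.2 rules (1)–(3)]
[folklore] -/
theorem of_sub_of_mem_relations_of_rotated (r : IntegralRep d) (P' : IntegralRep (d + 1 + 1 + 1))
    (hdom : ∀ z, z ∈ P'.domain ↔ (0 < z (Fin.last (d + 1 + 1)) ∧ z (Fin.last (d + 1 + 1)) < 1) ∧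
        (0 < z 0 ∧ z 0 < 1) ∧ (z (Fin.last (d + 1 + 1)) ≤ z 1 ∧ z 1 ≤ 1) ∧
        (fun l : Fin d => z l.castSucc.succ.succ) ∈ r.domain)
    (hint : P'.integrand = fun z => (z 1)⁻¹ * r.integrand (fun l : Fin d => z l.castSucc.succ.succ)) :
    of P' - of r ∈ relations := by
  -- the base: the double constant family `(0,1) × ((0,1) × r)`
  have hBmem : ∀ x : Fin (d + 1 + 1) → ℝ, x ∈ r.cylinder.cylinder.domain ↔
      (0 < x 0 ∧ x 0 < 1) ∧ (0 < x 1 ∧ x 1 < 1) ∧ (fun l : Fin d => x l.succ.succ) ∈ r.domain := by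
    intro x
    simp only [IntegralRep.domain_cylinder, IntegralRep.cylinderDomain, mem_setOf_eq,
      Fin.succ_zero_eq_one]
    tauto
  -- the band `0 ≤ s ≤ y` over the base
  set S : Set (Fin (d + 1 + 1 + 1) → ℝ) := {z : Fin (d + 1 + 1 + 1) → ℝ |
    (Fin.init z : Fin (d + 1 + 1) → ℝ) ∈ r.cylinder.cylinder.domain ∧
    0 ≤ z (Fin.last (d + 1 + 1)) ∧ z (Fin.last (d + 1 + 1)) ≤ Fin.init z 1} with hS_def
  have hSmem : ∀ z, z ∈ S ↔ ((0 < z 0 ∧ z 0 < 1) ∧ (0 < z 1 ∧ z 1 < 1) ∧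
      (fun l : Fin d => z l.castSucc.succ.succ) ∈ r.domain) ∧
      0 ≤ z (Fin.last (d + 1 + 1)) ∧ z (Fin.last (d + 1 + 1)) ≤ z 1 := by
    intro z
    rw [hS_def, mem_setOf_eq, hBmem]
    simp only [Fin.init, Fin.castSucc_zero, Fin.castSucc_one, Fin.castSucc_succ]
  have hSsa : IsSemialgebraic ℚ S := by
    have h1 : IsSemialgebraic ℚ
        {z : Fin (d + 1 + 1 + 1) → ℝ | (0 : ℝ) ≤ z (Fin.last (d + 1 + 1))} := by
      simpa using isSemialgebraic_setOf_eval_le (k := ℚ) (R := ℝ)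
        (0 : MvPolynomial (Fin (d + 1 + 1 + 1)) ℚ) (X (Fin.last (d + 1 + 1)))
    have h2 : IsSemialgebraic ℚ
        {z : Fin (d + 1 + 1 + 1) → ℝ | z (Fin.last (d + 1 + 1)) ≤ z 1} := by
      simpa using isSemialgebraic_setOf_eval_le (k := ℚ) (R := ℝ)
        (X (Fin.last (d + 1 + 1)) : MvPolynomial (Fin (d + 1 + 1 + 1)) ℚ) (X 1)
    rw [hS_def]
    convert (r.cylinder.cylinder.isSemialgebraic_domain.setOf_init_mem.inter h1).inter h2 using 1
    ext z
    simp only [mem_setOf_eq, mem_inter_iff, and_assoc, Fin.init, Fin.castSucc_one]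
  -- coordinate hyperplanes are null
  have hface : ∀ (i : Fin (d + 1 + 1 + 1)) (c : ℝ),
      volume {z : Fin (d + 1 + 1 + 1) → ℝ | z i = c} = 0 := fun i c => by
    simpa [volume_pi] using
      Measure.pi_hyperplane (fun _ : Fin (d + 1 + 1 + 1) => (volume : Measure ℝ)) i c
  -- `S ⊆ P'.domain ∪ {s = 0}` and `P'.domain ⊆ S ∪ {y = 1}`
  have hSP : ∀ z ∈ S, z (Fin.last (d + 1 + 1)) ≠ 0 → z ∈ P'.domain := by
    intro z hz hs
    obtain ⟨⟨hu, hy, hw⟩, hs0, hsy⟩ := (hSmem z).1 hz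
    rw [hdom]
    exact ⟨⟨lt_of_le_of_ne hs0 (Ne.symm hs), by linarith [hy.2]⟩, hu, ⟨hsy, hy.2.le⟩, hw⟩
  have hPS : ∀ z ∈ P'.domain, z 1 ≠ 1 → z ∈ S := by
    intro z hz hy1
    obtain ⟨⟨hs, _⟩, hu, ⟨hsy, hy1'⟩, hw⟩ := (hdom z).1 hz
    rw [hSmem]
    exact ⟨⟨hu, ⟨by linarith, lt_of_le_of_ne hy1' hy1⟩, hw⟩, hs.le, hsy⟩
  -- the band representation `R = (S, y⁻¹ · r(w))`
  have hgS : IsSemialgebraicFunOn ℚ S P'.integrand := by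
    rw [hint]
    refine IsSemialgebraicFunOn.mul_holds ?_ ?_
    · exact (isSemialgebraicFunOn_apply hSsa 1).inv fun z hz => ((hSmem z).1 hz).1.2.1.1.ne'
    · exact (isSemialgebraicFunOn_comp_coords r.isSemialgebraicFunOn_integrand
        (fun l : Fin d => l.castSucc.succ.succ)).mono (fun z hz => ((hSmem z).1 hz).1.2.2) hSsa
  have hintS : IntegrableOn P'.integrand S := by
    refine (P'.integrableOn.union (IntegrableOn.of_measure_zero (hface (Fin.last _) 0))).mono_set
      fun z hz => ?_
    by_cases hs : z (Fin.last (d + 1 + 1)) = 0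
    · exact Or.inr hs
    · exact Or.inl (hSP z hz hs)
  obtain ⟨R, hRd, hRi⟩ : ∃ R : IntegralRep (d + 1 + 1 + 1),
      R.domain = S ∧ R.integrand = P'.integrand :=
    ⟨⟨S, P'.integrand, hSsa, hgS, hintS⟩, rfl, rfl⟩
  -- one Newton–Leibniz move under the roof `s ≤ y`
  have h5 : of R - of r.cylinder.cylinder ∈ relations := by
    refine of_sub_of_mem_relations_of_coordBand R r.cylinder.cylinder 1
      (fun x => (x 1)⁻¹ * r.integrand (fun l : Fin d => x l.succ.succ)) (fun x hx => ?_)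
      (hRd.trans hS_def) (fun z _ => ?_) (fun x hx => ?_)
    · exact ((hBmem x).1 hx).2.1.1.le
    · rw [hRi, hint]
      simp only [Fin.init, Fin.castSucc_one, Fin.castSucc_succ]
    · have hy : x 1 ≠ 0 := ((hBmem x).1 hx).2.1.1.ne'
      simp only [IntegralRep.integrand_cylinder]
      rw [← mul_assoc, mul_inv_cancel₀ hy, one_mul]
  -- compare `P'` and the band `R` on `E = P'.domain ∩ S` (null differences)
  have hE : IsSemialgebraic ℚ (P'.domain ∩ S) := P'.isSemialgebraic_domain.inter hSsa
  have hEP : P'.domain ∩ S ⊆ P'.domain := inter_subset_left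
  have hER : P'.domain ∩ S ⊆ R.domain := by
    rw [hRd]
    exact inter_subset_right
  have h2 : of P' - of (P'.restrict _ hE hEP) ∈ relations := by
    refine P'.of_sub_of_restrict_mem_relations hE hEP
      (measure_mono_null (fun z hz => ?_) (hface 1 1))
    by_contra hy1
    exact hz.2 ⟨hz.1, hPS z hz.1 hy1⟩
  have h4 : of R - of (R.restrict _ hE hER) ∈ relations := by
    refine R.of_sub_of_restrict_mem_relations hE hER
      (measure_mono_null (fun z hz => ?_) (hface (Fin.last _) 0))
    by_contra hs
    rw [hRd] at hz
    exact hz.2 ⟨hSP z hz.1 hs, hz.1⟩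
  have h3 : of (P'.restrict _ hE hEP) - of (R.restrict _ hE hER) ∈ relations :=
    of_sub_of_mem_relations_of_eqOn rfl fun z _ => by
      simp only [IntegralRep.integrand_restrict, hRi]
  have h6 : of r.cylinder.cylinder - of r.cylinder ∈ relations :=
    of_cylinder_sub_of_mem_relations r.cylinder
  have h7 : of r.cylinder - of r ∈ relations := of_cylinder_sub_of_mem_relations r
  have : of P' - of r = (of P' - of (P'.restrict _ hE hEP)) +
      (of (P'.restrict _ hE hEP) - of (R.restrict _ hE hER)) - (of R - of (R.restrict _ hE hER)) +
      (of R - of r.cylinder.cylinder) + (of r.cylinder.cylinder - of r.cylinder) +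
      (of r.cylinder - of r) := by
    abel
  rw [this]
  exact relations.add_mem (relations.add_mem (relations.add_mem (relations.sub_mem
    (relations.add_mem h2 h3) h4) h5) h6) h7

/-! ### The stub -/

/-- **Stub `stub_logFamily_total` of the crux `CTConstruction`** (stmt-KontsevichZagierPeriods-3495,
line `registered`): the total space of the log-elementary divergent product family
`P = P(0, q, 1, d, r)` (domain `0 < s < 1`, `0 < u`, `u ^ q · s ^ 0 < 1`, `s ≤ y ≤ 1`,
`w ∈ r.domain`; integrand `y⁻¹ · r.integrand w`; value `∫₀¹ log (1/s) ds · r.value = r.value`)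
is move-equivalent to its coefficient: `[P] − [r] ∈ KZ.relations` (rotation
`exists_reindex_logFamily`, then `of_sub_of_mem_relations_of_rotated`).
[Kontsevich–Zagier 2001, §1.2 rules (1)–(3)] [folklore] -/
theorem stub_logFamily_total : ∀ (q d : ℕ) (r : Literature.NumberTheory.Transcendental.KZ.IntegralRep d) (P : Literature.NumberTheory.Transcendental.KZ.IntegralRep (1 + d + 1 + 1)), 0 < q → P.domain = {z | ∃ (s u : ℝ) (y : Fin 1 → ℝ) (w : Fin d → ℝ), z = Matrix.vecCons s (Matrix.vecCons u (Fin.append y w)) ∧ 0 < s ∧ s < 1 ∧ 0 < u ∧ u ^ q * s ^ 0 < 1 ∧ (∀ j, s ≤ y j ∧ y j ≤ 1) ∧ w ∈ r.domain} → P.integrand = (fun z => (∏ j : Fin 1, (z (Fin.castAdd d j).succ.succ)⁻¹) * r.integrand (fun l : Fin d => z (Fin.natAdd 1 l).succ.succ)) → Literature.NumberTheory.Transcendental.KZ.of P - Literature.NumberTheory.Transcendental.KZ.of r ∈ Literature.NumberTheory.Transcendental.KZ.relations := by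
  intro q d r P hq hdom hint
  obtain ⟨P', h1, hdom', hint'⟩ := exists_reindex_logFamily hq r P hdom hint
  have h2 := of_sub_of_mem_relations_of_rotated r P' hdom' hint'
  have : of P - of r = (of P - of P') + (of P' - of r) := by abel
  rw [this]
  exact relations.add_mem h1 h2

end Summit.KontsevichZagierPeriods.ValuedFieldSpecialisation
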